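import Summits.BirchSwinnertonDyer.BirchSwinnertonDyer.Theorems.PrintCf2SplitBadTwoLocNilSurjectiveInfinite
import Summits.BirchSwinnertonDyer.BirchSwinnertonDyer.Theorems.PrintCf2SplitBadTwoUnrNotStrictOfLevel
import Summits.BirchSwinnertonDyer.BirchSwinnertonDyer.Theorems.PrintCf2SplitBadTwoStrictDatumOfUnrDatum
import Literature.NumberTheory.EllipticCurves.ZpExtensionDescentProofs
import HarnessLib

/-!
# «`Q = S_M(K_∞)/𝔖_{v̄}(K_∞, M)` is INFINITE» ⟸ (Q ≠ 0) ∧ (S_M(K_∞))_Γ = 0 — the S3d class-(iii) bit, ASSEMBLED generically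
# (helper for crux stmt-BirchSwinnertonDyer-20368 `PrintCf2.SplitBadTwoRankOneOfFacts`; cell `bsd-print-cf2`,
# seat `bsd-line-cf2-p1-w7` g5; consumed by -w3 g11's `StrictDefect.hasCharValuationAt_restricted_of_unr_of_injective_of_not_finite` as `hQ`)

For a `ℤ_p`-line `κ` of a number field `K` (`K_∞ = K̄^{ker κ}`, topological generator `γ`), a discrete
`p`-primary `Γ_K`-module `M` with open stabilisers and a place `v̄`:
* **`not_finite_unrSelmer_quot_restrictedSelmerZp_of_forall_exists`** — if `conj_γ − 1` is ONTO
  `S_M(K_∞) = unrSelmer κ M v̄ ∅` (`(S_M(K_∞))_Γ = 0`, -w4 g11's (B)) and `𝔖_{v̄}(K_∞, M) ≠ S_M(K_∞)` ((Q ≠ 0)), then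
  the quotient `Q` is infinite: `conj_γ − 1` is locally nilpotent on the `p`-primary group `S_M(K_∞)`
  (`KellerYin2024.isLocNil_conjUnr_sub_one`) and preserves `𝔖` (`Agboola2007.conjH1_mem_restrictedSelmerZp`), so the pure
  algebra `not_finite_quotient_of_forall_exists_sub_mem` (p691114) applies;
* `…_of_natCard_endCoinvariants_eq_one` — the same with (B) in -w4 g11's currency
  `Nat.card (EndCoinvariants (conjUnr κ M v̄ ∅ γ − 1)) = 1`;
* `…_of_level` — (Q ≠ 0) discharged by a level-`K` class (`restrictedSelmerZp_addSubgroupOf_unrSelmer_ne_top_of_level`,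
  p691913); **`…_of_local`** — the same in the currency of the Poitou–Tate surjectivity (LS):
  `g : H¹(Γ_K, M)` with `res_{D_w} g = 0` at the finite `w ∤ p` and `res_{D_v̄} g = τ`, `τ` unramified with
  `res_{ker κ ⊓ D_v̄} τ ≠ 0` (`restrictedSelmerZp_addSubgroupOf_unrSelmer_ne_top_of_local`).

HONEST FRAMING: bookkeeping only; the arithmetic inputs ((B) modulo -w4 g11's local hypothesis `h𝓛`; the local
class `τ` at `v̄`; (LS)) are NOT proved here.  Closes nothing (`--supports`).  No named fact, no definition, no `sorry`.
No summit statement is proved by this file; BSD is not proved by any of this.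

References: Greenberg–Vatsal 2000 §2 Prop. 2.1, Cor. 2.3; Greenberg LNM 1716 §1 (local nilpotence), §4 p. 124;
Agboola 2007 §3 Prop. 3.2.
-/

-- the summit namespace `Summit.BirchSwinnertonDyer.BirchSwinnertonDyer` repeats the problem name by design (D-0017)
set_option linter.dupNamespace false
set_option autoImplicit false

noncomputable section

open scoped Classical
open NumberField IsDedekindDomain Field
open Literature.NumberTheory.EllipticCurves Literature.NumberTheory.EllipticCurves.GreenbergSelmer
open Literature.NumberTheory.EllipticCurves.GreenbergVatsal2000 Literature.NumberTheory.EllipticCurves.KellerYin2024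
open Literature.NumberTheory.EllipticCurves.Agboola2007 Literature.NumberTheory.EllipticCurves.IwasawaDual
open Literature.NumberTheory.GaloisRepresentations
open Summit.BirchSwinnertonDyer.BirchSwinnertonDyer.Theorems.PrintCf2

namespace Summit.BirchSwinnertonDyer.BirchSwinnertonDyer.Theorems.PrintCf2.StrictDefectInfinite

variable {K : Type} [Field K] [NumberField K] {p : ℕ} [Fact p.Prime] (κ : ZpExtension K p)
  (M : Type) [AddCommGroup M] [DistribMulAction (absoluteGaloisGroup K) M] [TopologicalSpace M]
  [DiscreteTopology M] {vbar : HeightOneSpectrum (𝓞 K)}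

/-- **`Q = S_M(K_∞)/𝔖_{v̄}(K_∞, M)` is infinite as soon as `conj_γ − 1` is onto `S_M(K_∞)` and `𝔖 ≠ S_M(K_∞)`.**
`M` `p`-primary with open stabilisers, `γ` a topological generator: `conj_γ − 1` is locally nilpotent on `S_M(K_∞)`
and preserves `𝔖`, so a finite nonzero quotient would carry a surjective locally nilpotent endomorphism — impossible.
[cite: GreenbergLNM1716, §1 (after Conj. 1.3) and §4 p. 124] [cite: GreenbergVatsal2000, §2 Cor. 2.3] -/
theorem not_finite_unrSelmer_quot_restrictedSelmerZp_of_forall_exists (htor : ∀ m : M, ∃ k : ℕ, p ^ k • m = 0)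
    (hstab : ∀ m : M, IsOpen (MulAction.stabilizer (absoluteGaloisGroup K) m : Set (absoluteGaloisGroup K)))
    {γ : absoluteGaloisGroup K} (hγ : κ.IsTopGenerator γ)
    (hcoinv : ∀ a : unrSelmer κ M vbar ∅, ∃ b : unrSelmer κ M vbar ∅, conjUnr κ M vbar ∅ γ b - b = a)
    (hne : (restrictedSelmerZp κ M vbar).addSubgroupOf (unrSelmer κ M vbar ∅) ≠ ⊤) :
    ¬ Finite (unrSelmer κ M vbar ∅ ⧸ (restrictedSelmerZp κ M vbar).addSubgroupOf (unrSelmer κ M vbar ∅)) := by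
  refine not_finite_quotient_of_forall_exists_sub_mem _
    ((conjUnr κ M vbar ∅ γ : AddMonoid.End (unrSelmer κ M vbar ∅)) : unrSelmer κ M vbar ∅ →+ unrSelmer κ M vbar ∅)
    (fun a ha ↦ ?_) (fun a ↦ ?_) hne (fun a ↦ ?_)
  · rw [AddSubgroup.mem_addSubgroupOf] at ha ⊢
    exact conjH1_mem_restrictedSelmerZp κ M vbar γ ha
  · obtain ⟨n, hn⟩ := (isLocNil_conjUnr_sub_one (vbar := vbar) (S₀ := ∅) κ htor hstab hγ).nil a
    exact ⟨n, hn⟩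
  · obtain ⟨b, hb⟩ := hcoinv a
    refine ⟨b, ?_⟩
    change conjUnr κ M vbar ∅ γ b - b - a ∈ _
    rw [hb, sub_self]
    exact zero_mem _

/-- **The same with (B) in the Herbrand currency `#(S_M(K_∞))_Γ = 1`** (-w4 g11's
`natCard_endCoinvariants_conjUnr_eq_one_of_frame`): `Nat.card (EndCoinvariants (conjUnr γ − 1)) = 1` says
`conj_γ − 1` is onto. [cite: GreenbergLNM1716, §4 p. 124] [cite: GreenbergVatsal2000, §2 Cor. 2.3] -/
theorem not_finite_unrSelmer_quot_restrictedSelmerZp_of_natCard_endCoinvariants_eq_one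
    (htor : ∀ m : M, ∃ k : ℕ, p ^ k • m = 0)
    (hstab : ∀ m : M, IsOpen (MulAction.stabilizer (absoluteGaloisGroup K) m : Set (absoluteGaloisGroup K)))
    {γ : absoluteGaloisGroup K} (hγ : κ.IsTopGenerator γ)
    (hcoinv : Nat.card (EndCoinvariants (conjUnr κ M vbar ∅ γ - 1)) = 1)
    (hne : (restrictedSelmerZp κ M vbar).addSubgroupOf (unrSelmer κ M vbar ∅) ≠ ⊤) :
    ¬ Finite (unrSelmer κ M vbar ∅ ⧸ (restrictedSelmerZp κ M vbar).addSubgroupOf (unrSelmer κ M vbar ∅)) := by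
  refine not_finite_unrSelmer_quot_restrictedSelmerZp_of_forall_exists κ M htor hstab hγ (fun a ↦ ?_) hne
  haveI : Subsingleton (EndCoinvariants (conjUnr κ M vbar ∅ γ - 1)) := (Nat.card_eq_one_iff_unique.mp hcoinv).1
  have h0 : (QuotientAddGroup.mk a : EndCoinvariants (conjUnr κ M vbar ∅ γ - 1)) = 0 := Subsingleton.elim _ _
  rw [QuotientAddGroup.eq_zero_iff, AddMonoidHom.mem_range] at h0
  obtain ⟨b, hb⟩ := h0
  exact ⟨b, hb⟩

/-- **`Q` infinite from (B) and a level-`K` class** locally trivial at the finite `w ∤ p`, unramified at `v̄`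
and non-zero on `ker κ ⊓ D_{v̄}` ((Q ≠ 0) by `restrictedSelmerZp_addSubgroupOf_unrSelmer_ne_top_of_level`).
[cite: GreenbergVatsal2000, §2 Prop. 2.1, Cor. 2.3] [cite: Agboola2007, §3 Prop. 3.2] -/
theorem not_finite_unrSelmer_quot_restrictedSelmerZp_of_level (hvbar : ((p : ℕ) : 𝓞 K) ∈ vbar.asIdeal)
    (htor : ∀ m : M, ∃ k : ℕ, p ^ k • m = 0)
    (hstab : ∀ m : M, IsOpen (MulAction.stabilizer (absoluteGaloisGroup K) m : Set (absoluteGaloisGroup K)))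
    {γ : absoluteGaloisGroup K} (hγ : κ.IsTopGenerator γ)
    (hcoinv : ∀ a : unrSelmer κ M vbar ∅, ∃ b : unrSelmer κ M vbar ∅, conjUnr κ M vbar ∅ γ b - b = a)
    (g : subgroupH1 (⊤ : Subgroup (absoluteGaloisGroup K)) M)
    (haway : ∀ w : HeightOneSpectrum (𝓞 K), ((p : ℕ) : 𝓞 K) ∉ w.asIdeal →
      resOfLe M (inf_le_left : ⊤ ⊓ decomp w ≤ ⊤) g = 0)
    (hunr : resOfLe M (inf_le_left : ⊤ ⊓ inertia vbar ≤ ⊤) g = 0)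
    (hnz : resOfLe M ((inf_le_left : κ.kerSubgroup ⊓ decomp vbar ≤ κ.kerSubgroup).trans
      (le_top : κ.kerSubgroup ≤ ⊤)) g ≠ 0) :
    ¬ Finite (unrSelmer κ M vbar ∅ ⧸ (restrictedSelmerZp κ M vbar).addSubgroupOf (unrSelmer κ M vbar ∅)) :=
  not_finite_unrSelmer_quot_restrictedSelmerZp_of_forall_exists κ M htor hstab hγ hcoinv
    (restrictedSelmerZp_addSubgroupOf_unrSelmer_ne_top_of_level κ M hvbar g haway hunr hnz)

omit [NumberField K] in
/-- Restriction along a chain `H₁ ≤ H₂ ≤ H₃` (the tree's `resOfLe_comp_holds`, element form). [folklore] -/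
private theorem resOfLe_resOfLe' {H₁ H₂ H₃ : Subgroup (absoluteGaloisGroup K)} (h₁₂ : H₁ ≤ H₂) (h₂₃ : H₂ ≤ H₃)
    (x : subgroupH1 H₃ M) : resOfLe M h₁₂ (resOfLe M h₂₃ x) = resOfLe M (h₁₂.trans h₂₃) x := by
  rw [← AddMonoidHom.comp_apply, resOfLe_comp_holds]

/-- **(Q ≠ 0) in the currency of the Poitou–Tate surjectivity (LS).**  A class `g ∈ H¹(Γ_K, M)` with
`res_{D_w} g = 0` at every finite `w ∤ p` and `res_{D_{v̄}} g = τ`, where the local class `τ ∈ H¹(D_{v̄}, M)` is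
UNRAMIFIED (`res_{D_{v̄} ⊓ I_{v̄}} τ = 0`) with `res_{ker κ ⊓ D_{v̄}} τ ≠ 0`, gives `𝔖_{v̄}(K_∞, M) ≠ S_M(K_∞)`
(restriction in stages, `ZpDescent.resOfLe_resSubgroup`, then `…_of_level`). [cite: GreenbergVatsal2000, §2 Prop. 2.1, Cor. 2.3] -/
theorem restrictedSelmerZp_addSubgroupOf_unrSelmer_ne_top_of_local (hvbar : ((p : ℕ) : 𝓞 K) ∈ vbar.asIdeal)
    (τ : subgroupH1 (decomp (K := K) vbar) M)
    (hτunr : resOfLe M (inf_le_left : decomp vbar ⊓ inertia vbar ≤ decomp vbar) τ = 0)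
    (hτnz : resOfLe M (inf_le_right : κ.kerSubgroup ⊓ decomp vbar ≤ decomp vbar) τ ≠ 0)
    (g : discreteH1 (absoluteGaloisGroup K) M) (hg : ResKernel.resSubgroup (decomp (K := K) vbar) M g = τ)
    (hg0 : ∀ w : HeightOneSpectrum (𝓞 K), ((p : ℕ) : 𝓞 K) ∉ w.asIdeal →
      ResKernel.resSubgroup (decomp (K := K) w) M g = 0) :
    (restrictedSelmerZp κ M vbar).addSubgroupOf (unrSelmer κ M vbar ∅) ≠ ⊤ := by
  refine restrictedSelmerZp_addSubgroupOf_unrSelmer_ne_top_of_level κ M hvbar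
    (ResKernel.resSubgroup (⊤ : Subgroup (absoluteGaloisGroup K)) M g) (fun w hw ↦ ?_) ?_ ?_
  · rw [ZpDescent.resOfLe_resSubgroup, ← ZpDescent.resOfLe_resSubgroup (inf_le_right : ⊤ ⊓ decomp w ≤ decomp w),
      hg0 w hw, map_zero]
  · have hle : (⊤ ⊓ inertia vbar : Subgroup (absoluteGaloisGroup K)) ≤ decomp vbar ⊓ inertia vbar :=
      le_inf (inf_le_right.trans (inertia_le_decomp vbar)) inf_le_right
    rw [ZpDescent.resOfLe_resSubgroup,
      ← ZpDescent.resOfLe_resSubgroup (hle.trans (inf_le_left : decomp vbar ⊓ inertia vbar ≤ decomp vbar)),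
      ← resOfLe_resOfLe' M hle (inf_le_left : decomp vbar ⊓ inertia vbar ≤ decomp vbar), hg, hτunr, map_zero]
  · rw [ZpDescent.resOfLe_resSubgroup, ← ZpDescent.resOfLe_resSubgroup (inf_le_right : κ.kerSubgroup ⊓ decomp vbar ≤ decomp vbar),
      hg]
    exact hτnz

/-- **«`Q` infinite» from (B) and (LS) + an unramified local class at `v̄` surviving restriction to the line**
(the shape in which the road-α frame supplies everything: (B) = -w4 g11 `natCard_endCoinvariants_conjUnr_eq_one_of_frame`,
(LS) = `ConjTransport.locSurjFin_of_poitouTate`, `τ` = this seat's next file).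
[cite: GreenbergVatsal2000, §2 Prop. 2.1, Cor. 2.3] [cite: GreenbergLNM1716, §4 p. 124] -/
theorem not_finite_unrSelmer_quot_restrictedSelmerZp_of_local (hvbar : ((p : ℕ) : 𝓞 K) ∈ vbar.asIdeal)
    (htor : ∀ m : M, ∃ k : ℕ, p ^ k • m = 0)
    (hstab : ∀ m : M, IsOpen (MulAction.stabilizer (absoluteGaloisGroup K) m : Set (absoluteGaloisGroup K)))
    {γ : absoluteGaloisGroup K} (hγ : κ.IsTopGenerator γ)
    (hcoinv : Nat.card (EndCoinvariants (conjUnr κ M vbar ∅ γ - 1)) = 1)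
    (τ : subgroupH1 (decomp (K := K) vbar) M)
    (hτunr : resOfLe M (inf_le_left : decomp vbar ⊓ inertia vbar ≤ decomp vbar) τ = 0)
    (hτnz : resOfLe M (inf_le_right : κ.kerSubgroup ⊓ decomp vbar ≤ decomp vbar) τ ≠ 0)
    (g : discreteH1 (absoluteGaloisGroup K) M) (hg : ResKernel.resSubgroup (decomp (K := K) vbar) M g = τ)
    (hg0 : ∀ w : HeightOneSpectrum (𝓞 K), ((p : ℕ) : 𝓞 K) ∉ w.asIdeal →
      ResKernel.resSubgroup (decomp (K := K) w) M g = 0) :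
    ¬ Finite (unrSelmer κ M vbar ∅ ⧸ (restrictedSelmerZp κ M vbar).addSubgroupOf (unrSelmer κ M vbar ∅)) :=
  not_finite_unrSelmer_quot_restrictedSelmerZp_of_natCard_endCoinvariants_eq_one κ M htor hstab hγ hcoinv
    (restrictedSelmerZp_addSubgroupOf_unrSelmer_ne_top_of_local κ M hvbar τ hτunr hτnz g hg hg0)

end Summit.BirchSwinnertonDyer.BirchSwinnertonDyer.Theorems.PrintCf2.StrictDefectInfinite

end
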